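import Literature.Geometry.DiscreteGeometry.TriangularLatticeContactBound
import Mathlib.Combinatorics.SimpleGraph.Acyclic
import Mathlib.Combinatorics.SimpleGraph.DegreeSum
import HarnessLib

/-!
# Unit triangles of a finite subset of the triangular lattice: Euler's relations

Topic `Literature/Geometry/DiscreteGeometry`; sequel to `TriangularLatticeRows.lean` /
`TriangularLatticeContactBound.lean` (labels `ℤ × ℤ` of `A₂`, `HarborthSpiral.Adj`, bonds by
direction, rows, the on-lattice Harborth bound and — `HarborthSpiral.mem_of_adjCount_eq` — the
row-convexity of the configurations attaining it).  Everything here is PROVED; no named facts.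

For a finite label set `S` (a "hexagonal animal" when connected) write `n = |S|`,
`b = horizBonds + vertBonds + diagBonds` (adjacent pairs, `bondCount`) and `A` (`triCount`) for the
number of UNIT TRIANGLES — the "up" triangles `{u, u + (1,0), u + (0,1)}` and the "down" triangles
`{v, v + (-1,1), v + (0,1)}` contained in `S` (`upTri`, `downTri`; every triple of pairwise
adjacent labels is one of these, `TriangularLatticeEdgeIsoperimetry.lean`).  In the dictionary
animal ↔ benzenoid system of Gutman–Cyvin (Ch. 3, §3.2: "`# internal edges = h - 1 + n_i`", `h`
cells, `n_i` internal vertices), `b` is the number of internal edges and `A` the number of internal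
vertices; for Davoli–Piovano–Stefanelli `A` is the "area" (25) and `2b - 3A` the "perimeter"
(26)/(29) of a configuration.

## Results

* `triCount_add_card_le_bondCount_add_one` — **Euler's inequality `A + n ≤ b + 1` for every
  bond-connected `S`**.  Proof without faces: delete from the bond graph the long edge of every up
  triangle and the top edge of every down triangle; the remaining graph is still connected (an
  induction up the rows re-routes every deleted bond through the third vertex of its triangle),
  has exactly `b - A` edges, and a connected graph on `n` vertices has `≥ n - 1` edges (Mathlib's
  `SimpleGraph.Connected.card_vert_le_card_edgeSet_add_one`).
* `bondCount_add_one_eq_of_isRowConvex` — **`b + 1 = A + n` for bond-connected ROW-CONVEX `S`**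
  (every horizontal row an integer interval: then the bonds between two consecutive rows form ONE
  zig-zag strip of `E ≥ 1` bonds carrying exactly `E - 1` triangles).
* `bondCount_add_one_eq_of_adjCount_eq` — hence `b + 1 = A + n` for every bond-connected `S`
  attaining Harborth's bound (such `S` are row-convex, `HarborthSpiral.mem_of_adjCount_eq`): the
  counting form of "all faces are triangles" in Heitmann–Radin's Theorem (2)(a), and the input of
  Davoli–Piovano–Stefanelli 2017, Theorem 1.1 (`TriangularLatticeEdgeIsoperimetry.lean`).

[cite: GutmanCyvin1989, Ch. 3 §3.2 (Harary–Harborth relations for hexagonal animals)];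
[cite: DavoliPiovanoStefanelli2017, (25)–(29) p. 635–636 and §2.1 Step 1 p. 641].
-/

noncomputable section

namespace Literature.Geometry.DiscreteGeometry

open Finset
open Literature.MathematicalPhysics.StatisticalMechanics

namespace HarborthSpiral

/-! ## §1 Bonds and unit triangles -/

/-- The number of adjacent (unordered) pairs of `S`, counted by direction
(`adjCount S = 2 · bondCount S`). [cite: HararyHarborth1976, hexagonal animals] -/
def bondCount (S : Finset (ℤ × ℤ)) : ℕ := horizBonds S + vertBonds S + diagBonds S

/-- `adjCount S = 2 · bondCount S`. [cite: HararyHarborth1976, hexagonal animals] -/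
theorem adjCount_eq_two_mul_bondCount (S : Finset (ℤ × ℤ)) : adjCount S = 2 * bondCount S :=
  adjCount_eq_two_mul S

/-- The "up" unit triangles `{u, u + (1,0), u + (0,1)} ⊆ S`, indexed by their vertex `u`.
[cite: DavoliPiovanoStefanelli2017, (25) p. 635] -/
def upTri (S : Finset (ℤ × ℤ)) : Finset (ℤ × ℤ) :=
  S.filter fun q => (q.1 + 1, q.2) ∈ S ∧ (q.1, q.2 + 1) ∈ S

/-- The "down" unit triangles `{v, v + (-1,1), v + (0,1)} ⊆ S`, indexed by their bottom vertex `v`.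
[cite: DavoliPiovanoStefanelli2017, (25) p. 635] -/
def downTri (S : Finset (ℤ × ℤ)) : Finset (ℤ × ℤ) :=
  S.filter fun q => (q.1 - 1, q.2 + 1) ∈ S ∧ (q.1, q.2 + 1) ∈ S

/-- The number `A(S)` of unit triangles of `S` (the "area" of Davoli–Piovano–Stefanelli).
[cite: DavoliPiovanoStefanelli2017, (25) p. 635] -/
def triCount (S : Finset (ℤ × ℤ)) : ℕ := (upTri S).card + (downTri S).card

/-- Membership in `upTri` (unfolding). [cite: DavoliPiovanoStefanelli2017, (25) p. 635] -/
@[simp] theorem mem_upTri {S : Finset (ℤ × ℤ)} {q : ℤ × ℤ} :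
    q ∈ upTri S ↔ q ∈ S ∧ (q.1 + 1, q.2) ∈ S ∧ (q.1, q.2 + 1) ∈ S := by
  simp [upTri]

/-- Membership in `downTri` (unfolding). [cite: DavoliPiovanoStefanelli2017, (25) p. 635] -/
@[simp] theorem mem_downTri {S : Finset (ℤ × ℤ)} {q : ℤ × ℤ} :
    q ∈ downTri S ↔ q ∈ S ∧ (q.1 - 1, q.2 + 1) ∈ S ∧ (q.1, q.2 + 1) ∈ S := by
  simp [downTri]

/-! ## §2 Bond-connected label sets -/

/-- `S` is **bond-connected**: any two labels of `S` are joined by a chain of labels of `S` with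
consecutive labels adjacent (a hexagonal "animal"). [cite: HararyHarborth1976, hexagonal animals] -/
def IsLabelConnected (S : Finset (ℤ × ℤ)) : Prop :=
  ∀ p ∈ S, ∀ q ∈ S, Relation.ReflTransGen (fun a b => a ∈ S ∧ b ∈ S ∧ Adj a b) p q

/-- Adjacent labels lie in the same or in consecutive rows. [cite: Theil2006, §2.3 Remark 2.5] -/
theorem Adj.snd_sub_le {a b : ℤ × ℤ} (h : Adj a b) : b.2 - a.2 ≤ 1 ∧ a.2 - b.2 ≤ 1 := by
  obtain ⟨a1, a2⟩ := a
  obtain ⟨b1, b2⟩ := b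
  rw [Adj, Prod.mk_sub_mk, normForm_eq_one_iff] at h
  simp only at h ⊢
  omega

/-- **Discrete intermediate value property along a chain.** If `p` is joined to `q` inside `S`
and `p.2 ≤ t < q.2`, some bond of the chain climbs from row `t` to row `t + 1`.
[cite: HararyHarborth1976, hexagonal animals] -/
theorem exists_adj_rows_of_reflTransGen {S : Finset (ℤ × ℤ)} {p q : ℤ × ℤ} {t : ℤ}
    (h : Relation.ReflTransGen (fun a b => a ∈ S ∧ b ∈ S ∧ Adj a b) p q)
    (hp : p.2 ≤ t) (hq : t < q.2) :
    ∃ a b : ℤ × ℤ, a ∈ S ∧ b ∈ S ∧ Adj a b ∧ a.2 = t ∧ b.2 = t + 1 := by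
  induction h with
  | refl => omega
  | tail hab hbc ih =>
    rename_i b c
    obtain ⟨hbS, hcS, hadj⟩ := hbc
    by_cases hb : t < b.2
    · exact ih hb
    · have := hadj.snd_sub_le
      exact ⟨b, c, hbS, hcS, hadj, by omega, by omega⟩

/-- In a bond-connected `S`, whenever some label lies in a row `≤ t` and some label in a row
`> t`, a bond joins row `t` to row `t + 1`: `rowBonds S t ≥ 1`. [cite: HararyHarborth1976, hexagonal animals] -/
theorem one_le_rowBonds_of_isLabelConnected {S : Finset (ℤ × ℤ)} (hS : IsLabelConnected S)
    {p q : ℤ × ℤ} (hp : p ∈ S) (hq : q ∈ S) {t : ℤ} (hpt : p.2 ≤ t) (htq : t < q.2) :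
    1 ≤ rowBonds S t := by
  obtain ⟨a, b, haS, hbS, hadj, hat, hbt⟩ := exists_adj_rows_of_reflTransGen (hS p hp q hq) hpt htq
  obtain ⟨a1, a2⟩ := a
  obtain ⟨b1, b2⟩ := b
  simp only at hat hbt
  subst hat hbt
  rw [Adj, Prod.mk_sub_mk, normForm_eq_one_iff] at hadj
  unfold rowBonds
  have ha : a1 ∈ row S a2 := mem_row.2 haS
  rcases hadj with ⟨h1, h2⟩ | ⟨h1, h2⟩ | ⟨h1, h2⟩ | ⟨h1, h2⟩ | ⟨h1, h2⟩ | ⟨h1, h2⟩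
  all_goals try (exfalso; omega)
  · -- `b = (a1, a2 + 1)`
    have hb : a1 ∈ row S (a2 + 1) := mem_row.2 (by convert hbS using 2; omega)
    have : 1 ≤ ((row S a2).filter fun m => m ∈ row S (a2 + 1)).card :=
      card_pos.2 ⟨a1, mem_filter.2 ⟨ha, hb⟩⟩
    omega
  · -- `b = (a1 - 1, a2 + 1)`
    have hb : a1 - 1 ∈ row S (a2 + 1) := mem_row.2 (by convert hbS using 2; omega)
    have : 1 ≤ ((row S a2).filter fun m => m - 1 ∈ row S (a2 + 1)).card :=
      card_pos.2 ⟨a1, mem_filter.2 ⟨ha, hb⟩⟩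
    omega

/-- In a bond-connected `S`, the occupied rows form an integer interval: every row between two
occupied rows is occupied. [cite: HararyHarborth1976, hexagonal animals] -/
theorem row_nonempty_of_isLabelConnected {S : Finset (ℤ × ℤ)} (hS : IsLabelConnected S)
    {p q : ℤ × ℤ} (hp : p ∈ S) (hq : q ∈ S) {t : ℤ} (hpt : p.2 ≤ t) (htq : t ≤ q.2) :
    (row S t).Nonempty := by
  rcases eq_or_lt_of_le htq with rfl | hlt
  · exact ⟨q.1, mem_row.2 hq⟩
  obtain ⟨a, b, haS, -, -, hat, -⟩ := exists_adj_rows_of_reflTransGen (hS p hp q hq) hpt hlt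
  exact ⟨a.1, mem_row.2 (by rw [← hat]; exact haS)⟩

/-! ## §3 The bond graph, the thinned bond graph, and Euler's inequality `A + n ≤ b + 1` -/

/-- The bond graph of `S` (vertices: the labels of `S`; edges: adjacent pairs). [cite: HararyHarborth1976, hexagonal animals] -/
def bondGraph (S : Finset (ℤ × ℤ)) : SimpleGraph S where
  Adj x y := Adj x.1 y.1
  symm := ⟨fun _ _ h => (adj_comm _ _).1 h⟩
  loopless := ⟨fun _ h => not_adj_self _ h⟩

/-- The bonds removed to kill the unit triangles: the long edge `(m+1,t) — (m,t+1)` of an up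
triangle (present third vertex `(m,t)`) and the top edge `(m-1,t+1) — (m,t+1)` of a down triangle
(present bottom vertex `(m,t)`), in both orientations. [folklore] -/
private abbrev Removed (S : Finset (ℤ × ℤ)) (p q : ℤ × ℤ) : Prop :=
  (q.1 + 1 = p.1 ∧ q.2 = p.2 + 1 ∧ (q.1, p.2) ∈ S) ∨
    (p.1 + 1 = q.1 ∧ p.2 = q.2 + 1 ∧ (p.1, q.2) ∈ S) ∨
    (q.1 = p.1 + 1 ∧ q.2 = p.2 ∧ (q.1, q.2 - 1) ∈ S) ∨
    (p.1 = q.1 + 1 ∧ p.2 = q.2 ∧ (p.1, p.2 - 1) ∈ S)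

/-- The removal rule is symmetric. [folklore] -/
private theorem removed_comm {S : Finset (ℤ × ℤ)} {p q : ℤ × ℤ} : Removed S p q ↔ Removed S q p := by
  unfold Removed
  tauto

/-- A removed pair is a bond. [folklore] -/
private theorem Removed.adj {S : Finset (ℤ × ℤ)} {p q : ℤ × ℤ} (h : Removed S p q) : Adj p q := by
  obtain ⟨p1, p2⟩ := p
  obtain ⟨q1, q2⟩ := q
  rw [Adj, Prod.mk_sub_mk, normForm_eq_one_iff]
  unfold Removed at h
  simp only at h ⊢
  omega

/-- The thinned bond graph: bonds that are not removed. [folklore] -/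
def thinGraph (S : Finset (ℤ × ℤ)) : SimpleGraph S where
  Adj x y := Adj x.1 y.1 ∧ ¬ Removed S x.1 y.1
  symm := ⟨fun _ _ h => ⟨(adj_comm _ _).1 h.1, fun h' => h.2 (removed_comm.1 h')⟩⟩
  loopless := ⟨fun _ h => not_adj_self _ h.1⟩

/-- Unfolding of the thinned adjacency. [folklore] -/
private theorem thinGraph_adj {S : Finset (ℤ × ℤ)} {x y : S} :
    (thinGraph S).Adj x y ↔ Adj x.1 y.1 ∧ ¬ Removed S x.1 y.1 := Iff.rfl

/-- Thinned adjacency from coordinates. [folklore] -/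
private theorem thinAdj_mk {S : Finset (ℤ × ℤ)} {a b : ℤ × ℤ} (ha : a ∈ S) (hb : b ∈ S) (h1 : Adj a b)
    (h2 : ¬ Removed S a b) : (thinGraph S).Adj ⟨a, ha⟩ ⟨b, hb⟩ := ⟨h1, h2⟩

/-- Vertical pairs `(m,t), (m,t')` are never removed. [folklore] -/
private theorem not_removed_vertical {S : Finset (ℤ × ℤ)} (m t t' : ℤ) :
    ¬ Removed S (m, t) (m, t') := by
  rintro (⟨h1, h2, -⟩ | ⟨h1, h2, -⟩ | ⟨h1, h2, -⟩ | ⟨h1, h2, -⟩) <;> simp only at h1 h2 <;> omega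

/-- A horizontal bond `(m,t) — (m+1,t)` is removed iff `(m+1, t-1) ∈ S`. [folklore] -/
private theorem removed_horizontal_iff {S : Finset (ℤ × ℤ)} (m t : ℤ) :
    Removed S (m, t) (m + 1, t) ↔ (m + 1, t - 1) ∈ S := by
  constructor
  · rintro (⟨h, -⟩ | ⟨-, h, -⟩ | ⟨-, -, h⟩ | ⟨h, -⟩)
    · exfalso; simp only at h; omega
    · exfalso; simp only at h; omega
    · exact h
    · exfalso; simp only at h; omega
  · intro h
    exact Or.inr (Or.inr (Or.inl ⟨rfl, rfl, h⟩))

/-- A long bond `(m+1,t) — (m,t')`, `t' = t + 1`, is removed iff `(m, t) ∈ S`. [folklore] -/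
private theorem removed_diagonal_iff {S : Finset (ℤ × ℤ)} (m t t' : ℤ) (ht : t' = t + 1) :
    Removed S (m + 1, t) (m, t') ↔ (m, t) ∈ S := by
  subst ht
  constructor
  · rintro (⟨-, -, h⟩ | ⟨h, -⟩ | ⟨h, -⟩ | ⟨-, h, -⟩)
    · exact h
    · exfalso; simp only at h; omega
    · exfalso; simp only at h; omega
    · exfalso; simp only at h; omega
  · intro h
    exact Or.inl ⟨rfl, rfl, h⟩

/-- Lattice adjacency from coordinates (the six unit vectors). [cite: Theil2006, §2.3 Remark 2.5] -/
private theorem adj_of_coords {p1 p2 q1 q2 : ℤ}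
    (h : (q1 - p1 = 1 ∧ q2 - p2 = 0) ∨ (q1 - p1 = -1 ∧ q2 - p2 = 0) ∨ (q1 - p1 = 0 ∧ q2 - p2 = 1) ∨
      (q1 - p1 = 0 ∧ q2 - p2 = -1) ∨ (q1 - p1 = 1 ∧ q2 - p2 = -1) ∨ (q1 - p1 = -1 ∧ q2 - p2 = 1)) :
    Adj (p1, p2) (q1, q2) := by
  rw [Adj, Prod.mk_sub_mk, normForm_eq_one_iff]
  exact h

/-- **The thinned graph re-routes every bond** (induction up the rows): for every row `t`,
(H) the two ends of a horizontal bond of row `t` and (D) the two ends of a long bond between rows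
`t` and `t + 1` are joined in the thinned graph. [folklore] -/
private theorem thinGraph_reachable_row (S : Finset (ℤ × ℤ)) (t : ℤ) :
    (∀ m (hp : (m, t) ∈ S) (hq : (m + 1, t) ∈ S),
        (thinGraph S).Reachable ⟨(m, t), hp⟩ ⟨(m + 1, t), hq⟩) ∧
      ∀ m (t' : ℤ) (_ : t' = t + 1) (hp : (m + 1, t) ∈ S) (hq : (m, t') ∈ S),
        (thinGraph S).Reachable ⟨(m + 1, t), hp⟩ ⟨(m, t'), hq⟩ := by
  -- induction on the height above a lower bound for the occupied rows
  suffices key : ∀ k : ℕ, ∀ t : ℤ, (∀ q ∈ S, t - k ≤ q.2) →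
      (∀ m (hp : (m, t) ∈ S) (hq : (m + 1, t) ∈ S),
          (thinGraph S).Reachable ⟨(m, t), hp⟩ ⟨(m + 1, t), hq⟩) ∧
        ∀ m (t' : ℤ) (_ : t' = t + 1) (hp : (m + 1, t) ∈ S) (hq : (m, t') ∈ S),
          (thinGraph S).Reachable ⟨(m + 1, t), hp⟩ ⟨(m, t'), hq⟩ by
    rcases S.eq_empty_or_nonempty with rfl | hne
    · exact ⟨fun m hp => absurd hp (by simp), fun m t' _ hp => absurd hp (by simp)⟩
    obtain ⟨t₀, ht₀⟩ : ∃ t₀ : ℤ, ∀ q ∈ S, t₀ ≤ q.2 :=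
      ⟨(S.image Prod.snd).min' (hne.image _), fun q hq => min'_le _ _ (mem_image_of_mem _ hq)⟩
    rcases le_or_gt t₀ t with h | h
    · exact key (t - t₀).toNat t fun q hq => by have := ht₀ q hq; omega
    · -- rows below `t₀` are empty
      exact ⟨fun m hp => by have := ht₀ _ hp; simp only at this; omega,
        fun m t' _ hp => by have := ht₀ _ hp; simp only at this; omega⟩
  intro k
  induction k using Nat.strong_induction_on with
  | _ k ih =>
  intro t hlow
  -- (H) for row `t`
  have hH : ∀ m (hp : (m, t) ∈ S) (hq : (m + 1, t) ∈ S),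
      (thinGraph S).Reachable ⟨(m, t), hp⟩ ⟨(m + 1, t), hq⟩ := by
    intro m hp hq
    by_cases hr : (m + 1, t - 1) ∈ S
    · -- re-route through `(m+1, t-1)`, using (D) of row `t - 1`
      have hk : 1 ≤ k := by have := hlow _ hr; simp only at this; omega
      have hD := (ih (k - 1) (by omega) (t - 1) fun q hq => by have := hlow q hq; omega).2 m t
        (by ring) hr hp
      have hv : (thinGraph S).Adj ⟨(m + 1, t - 1), hr⟩ ⟨(m + 1, t), hq⟩ :=
        thinAdj_mk hr hq (adj_of_coords (by omega)) (not_removed_vertical (m + 1) (t - 1) t)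
      exact hD.symm.trans hv.reachable
    · exact (thinAdj_mk hp hq (adj_of_coords (by omega))
        fun h => hr ((removed_horizontal_iff m t).1 h)).reachable
  refine ⟨hH, ?_⟩
  -- (D) for row `t`
  intro m t' ht' hp hq
  by_cases hr : (m, t) ∈ S
  · have hv : (thinGraph S).Adj ⟨(m, t), hr⟩ ⟨(m, t'), hq⟩ :=
      thinAdj_mk hr hq (adj_of_coords (by omega)) (not_removed_vertical m t t')
    exact (hH m hr hp).symm.trans hv.reachable
  · exact (thinAdj_mk hp hq (adj_of_coords (by omega))
      fun h => hr ((removed_diagonal_iff m t t' ht').1 h)).reachable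

/-- Every bond is re-routed in the thinned graph. [folklore] -/
private theorem thinGraph_reachable_of_adj {S : Finset (ℤ × ℤ)} (x y : S) (h : (bondGraph S).Adj x y) :
    (thinGraph S).Reachable x y := by
  obtain ⟨⟨p1, p2⟩, hp⟩ := x
  obtain ⟨⟨q1, q2⟩, hq⟩ := y
  change Adj (p1, p2) (q1, q2) at h
  rw [Adj, Prod.mk_sub_mk, normForm_eq_one_iff] at h
  rcases h with ⟨h1, h2⟩ | ⟨h1, h2⟩ | ⟨h1, h2⟩ | ⟨h1, h2⟩ | ⟨h1, h2⟩ | ⟨h1, h2⟩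
  · -- `q = (p1 + 1, p2)`
    obtain rfl : q1 = p1 + 1 := by omega
    obtain rfl : q2 = p2 := by omega
    exact (thinGraph_reachable_row S q2).1 p1 hp hq
  · -- `q = (p1 - 1, p2)`
    obtain rfl : p1 = q1 + 1 := by omega
    obtain rfl : q2 = p2 := by omega
    exact ((thinGraph_reachable_row S q2).1 q1 hq hp).symm
  · -- `q = (p1, p2 + 1)`
    obtain rfl : q1 = p1 := by omega
    exact (thinAdj_mk hp hq (adj_of_coords (by omega)) (not_removed_vertical q1 p2 q2)).reachable
  · -- `q = (p1, p2 - 1)`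
    obtain rfl : q1 = p1 := by omega
    exact (thinAdj_mk hq hp (adj_of_coords (by omega)) (not_removed_vertical q1 q2 p2)).reachable.symm
  · -- `q = (p1 + 1, p2 - 1)`: a long bond between rows `q2` and `p2 = q2 + 1`
    obtain rfl : q1 = p1 + 1 := by omega
    exact ((thinGraph_reachable_row S q2).2 p1 p2 (by omega) hq hp).symm
  · -- `q = (p1 - 1, p2 + 1)`
    obtain rfl : p1 = q1 + 1 := by omega
    exact (thinGraph_reachable_row S p2).2 q1 q2 (by omega) hp hq

/-- The bond graph of a bond-connected non-empty `S` is connected. [cite: HararyHarborth1976, hexagonal animals] -/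
theorem bondGraph_connected {S : Finset (ℤ × ℤ)} (hne : S.Nonempty) (hS : IsLabelConnected S) :
    (bondGraph S).Connected := by
  obtain ⟨p₀, hp₀⟩ := hne
  rw [SimpleGraph.connected_iff_exists_forall_reachable]
  refine ⟨⟨p₀, hp₀⟩, fun y => ?_⟩
  -- transport the chain into the subtype
  suffices ∀ q (hq : q ∈ S), Relation.ReflTransGen (fun a b => a ∈ S ∧ b ∈ S ∧ Adj a b) p₀ q →
      (bondGraph S).Reachable ⟨p₀, hp₀⟩ ⟨q, hq⟩ from this y.1 y.2 (hS p₀ hp₀ y.1 y.2)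
  intro q hq h
  induction h with
  | refl => exact SimpleGraph.Reachable.refl _
  | tail hab hbc ih =>
    rename_i b c
    exact (ih hbc.1).trans (SimpleGraph.Adj.reachable (show (bondGraph S).Adj ⟨b, hbc.1⟩ ⟨c, hq⟩
      from hbc.2.2))

/-- The thinned bond graph of a bond-connected non-empty `S` is connected. [folklore] -/
private theorem thinGraph_connected {S : Finset (ℤ × ℤ)} (hne : S.Nonempty) (hS : IsLabelConnected S) :
    (thinGraph S).Connected := by
  have : Nonempty S := hne.coe_sort
  have hc := bondGraph_connected hne hS
  rw [SimpleGraph.connected_iff_exists_forall_reachable]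
  obtain ⟨x⟩ := this
  refine ⟨x, fun y => ?_⟩
  obtain ⟨w⟩ := hc x y
  induction w with
  | nil => exact SimpleGraph.Reachable.refl _
  | cons hadj _ ih => exact (thinGraph_reachable_of_adj _ _ hadj).trans ih

/-- `#((S ×ˢ S).filter P) = ∑_{a ∈ S} #{b ∈ S | P a b}`. [folklore] -/
private theorem card_filter_prod_eq_sum (S : Finset (ℤ × ℤ)) (P : ℤ × ℤ → ℤ × ℤ → Prop)
    [DecidableRel P] :
    ((S ×ˢ S).filter fun d => P d.1 d.2).card = ∑ a ∈ S, (S.filter (P a)).card := by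
  rw [card_filter, sum_product]
  refine sum_congr rfl fun a _ => ?_
  rw [card_filter]

/-- The ordered bonds of `S` number `adjCount S`. [cite: HararyHarborth1976, hexagonal animals] -/
private theorem card_filter_adj_prod (S : Finset (ℤ × ℤ)) :
    ((S ×ˢ S).filter fun d => Adj d.1 d.2).card = adjCount S := by
  rw [card_filter_prod_eq_sum]
  rfl

/-- The ordered removed pairs are re-indexed unit triangles: each of the four clauses of `Removed`
contributes `#upTri` resp. `#downTri`, so they number `2 A(S)`. [folklore] -/
private theorem card_filter_removed_prod (S : Finset (ℤ × ℤ)) :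
    ((S ×ˢ S).filter fun d => Removed S d.1 d.2).card = 2 * triCount S := by
  -- the four clauses
  set F1 := (S ×ˢ S).filter fun d => d.2.1 + 1 = d.1.1 ∧ d.2.2 = d.1.2 + 1 ∧ (d.2.1, d.1.2) ∈ S
    with hF1
  set F2 := (S ×ˢ S).filter fun d => d.1.1 + 1 = d.2.1 ∧ d.1.2 = d.2.2 + 1 ∧ (d.1.1, d.2.2) ∈ S
    with hF2
  set F3 := (S ×ˢ S).filter fun d => d.2.1 = d.1.1 + 1 ∧ d.2.2 = d.1.2 ∧ (d.2.1, d.2.2 - 1) ∈ S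
    with hF3
  set F4 := (S ×ˢ S).filter fun d => d.1.1 = d.2.1 + 1 ∧ d.1.2 = d.2.2 ∧ (d.1.1, d.1.2 - 1) ∈ S
    with hF4
  have hsplit : ((S ×ˢ S).filter fun d => Removed S d.1 d.2) = F1 ∪ F2 ∪ F3 ∪ F4 := by
    ext d
    simp only [hF1, hF2, hF3, hF4, mem_filter, mem_union, Removed]
    tauto
  -- each clause set is in bijection with `upTri` / `downTri`
  have c1 : F1.card = (upTri S).card := by
    refine card_nbij' (fun d => (d.2.1, d.1.2)) (fun u => ((u.1 + 1, u.2), (u.1, u.2 + 1)))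
      ?_ ?_ ?_ ?_
    · rintro ⟨⟨p1, p2⟩, ⟨q1, q2⟩⟩ hd
      simp only [hF1, coe_filter, Set.mem_setOf_eq, mem_product] at hd
      obtain ⟨⟨hp, hq⟩, h1, h2, h3⟩ := hd
      simp only [mem_coe, mem_upTri]
      exact ⟨h3, by rw [h1]; exact hp, by rw [← h2]; exact hq⟩
    · rintro ⟨u1, u2⟩ hu
      simp only [mem_coe, mem_upTri] at hu
      simp only [mem_coe, hF1, mem_filter, mem_product]
      refine ⟨⟨?_, ?_⟩, ?_, ?_, ?_⟩ <;> first
        | trivial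
        | exact hu.1
        | exact hu.2.1
        | exact hu.2.2
    · rintro ⟨⟨p1, p2⟩, ⟨q1, q2⟩⟩ hd
      simp only [hF1, coe_filter, Set.mem_setOf_eq, mem_product] at hd
      obtain ⟨-, h1, h2, -⟩ := hd
      refine Prod.ext (Prod.ext ?_ ?_) (Prod.ext ?_ ?_) <;> simp only <;> omega
    · rintro ⟨u1, u2⟩ _
      refine Prod.ext ?_ ?_ <;> simp only
  have c2 : F2.card = (upTri S).card := by
    refine card_nbij' (fun d => (d.1.1, d.2.2)) (fun u => ((u.1, u.2 + 1), (u.1 + 1, u.2)))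
      ?_ ?_ ?_ ?_
    · rintro ⟨⟨p1, p2⟩, ⟨q1, q2⟩⟩ hd
      simp only [hF2, coe_filter, Set.mem_setOf_eq, mem_product] at hd
      obtain ⟨⟨hp, hq⟩, h1, h2, h3⟩ := hd
      simp only [mem_coe, mem_upTri]
      exact ⟨h3, by rw [h1]; exact hq, by rw [← h2]; exact hp⟩
    · rintro ⟨u1, u2⟩ hu
      simp only [mem_coe, mem_upTri] at hu
      simp only [mem_coe, hF2, mem_filter, mem_product]
      refine ⟨⟨?_, ?_⟩, ?_, ?_, ?_⟩ <;> first
        | trivial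
        | exact hu.1
        | exact hu.2.1
        | exact hu.2.2
    · rintro ⟨⟨p1, p2⟩, ⟨q1, q2⟩⟩ hd
      simp only [hF2, coe_filter, Set.mem_setOf_eq, mem_product] at hd
      obtain ⟨-, h1, h2, -⟩ := hd
      refine Prod.ext (Prod.ext ?_ ?_) (Prod.ext ?_ ?_) <;> simp only <;> omega
    · rintro ⟨u1, u2⟩ _
      refine Prod.ext ?_ ?_ <;> simp only
  have c3 : F3.card = (downTri S).card := by
    refine card_nbij' (fun d => (d.2.1, d.2.2 - 1)) (fun v => ((v.1 - 1, v.2 + 1), (v.1, v.2 + 1)))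
      ?_ ?_ ?_ ?_
    · rintro ⟨⟨p1, p2⟩, ⟨q1, q2⟩⟩ hd
      simp only [hF3, coe_filter, Set.mem_setOf_eq, mem_product] at hd
      obtain ⟨⟨hp, hq⟩, h1, h2, h3⟩ := hd
      simp only [mem_coe, mem_downTri]
      refine ⟨h3, ?_, ?_⟩
      · convert hp using 2 <;> omega
      · convert hq using 2; omega
    · rintro ⟨u1, u2⟩ hu
      simp only [mem_coe, mem_downTri] at hu
      simp only [mem_coe, hF3, mem_filter, mem_product]
      refine ⟨⟨?_, ?_⟩, ?_, ?_, ?_⟩ <;> first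
        | trivial
        | exact hu.1
        | exact hu.2.1
        | exact hu.2.2
        | omega
        | (simpa using hu.1)
    · rintro ⟨⟨p1, p2⟩, ⟨q1, q2⟩⟩ hd
      simp only [hF3, coe_filter, Set.mem_setOf_eq, mem_product] at hd
      obtain ⟨-, h1, h2, -⟩ := hd
      refine Prod.ext (Prod.ext ?_ ?_) (Prod.ext ?_ ?_) <;> simp only <;> omega
    · rintro ⟨u1, u2⟩ _
      refine Prod.ext ?_ ?_ <;> simp only
      omega
  have c4 : F4.card = (downTri S).card := by
    refine card_nbij' (fun d => (d.1.1, d.1.2 - 1)) (fun v => ((v.1, v.2 + 1), (v.1 - 1, v.2 + 1)))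
      ?_ ?_ ?_ ?_
    · rintro ⟨⟨p1, p2⟩, ⟨q1, q2⟩⟩ hd
      simp only [hF4, coe_filter, Set.mem_setOf_eq, mem_product] at hd
      obtain ⟨⟨hp, hq⟩, h1, h2, h3⟩ := hd
      simp only [mem_coe, mem_downTri]
      refine ⟨h3, ?_, ?_⟩
      · convert hq using 2 <;> omega
      · convert hp using 2; omega
    · rintro ⟨u1, u2⟩ hu
      simp only [mem_coe, mem_downTri] at hu
      simp only [mem_coe, hF4, mem_filter, mem_product]
      refine ⟨⟨?_, ?_⟩, ?_, ?_, ?_⟩ <;> first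
        | trivial
        | exact hu.1
        | exact hu.2.1
        | exact hu.2.2
        | omega
        | (simpa using hu.1)
    · rintro ⟨⟨p1, p2⟩, ⟨q1, q2⟩⟩ hd
      simp only [hF4, coe_filter, Set.mem_setOf_eq, mem_product] at hd
      obtain ⟨-, h1, h2, -⟩ := hd
      refine Prod.ext (Prod.ext ?_ ?_) (Prod.ext ?_ ?_) <;> simp only <;> omega
    · rintro ⟨u1, u2⟩ _
      refine Prod.ext ?_ ?_ <;> simp only
      omega
  -- pairwise disjointness: the four clauses fix four different differences `q - p`
  have d12 : Disjoint F1 F2 := by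
    rw [disjoint_left]; intro d h1 h2
    simp only [hF1, hF2, mem_filter] at h1 h2; omega
  have d123 : Disjoint (F1 ∪ F2) F3 := by
    rw [disjoint_left]; intro d h1 h2
    simp only [hF1, hF2, hF3, mem_filter, mem_union] at h1 h2; omega
  have d1234 : Disjoint (F1 ∪ F2 ∪ F3) F4 := by
    rw [disjoint_left]; intro d h1 h2
    simp only [hF1, hF2, hF3, hF4, mem_filter, mem_union] at h1 h2; omega
  rw [hsplit, card_union_of_disjoint d1234, card_union_of_disjoint d123, card_union_of_disjoint d12,
    c1, c2, c3, c4, triCount]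
  ring

/-- **The thinned bond graph has exactly `b - A` edges** (in the form `2|E'| + 2A = 2b`). [folklore] -/
private theorem two_mul_card_edgeSet_thinGraph (S : Finset (ℤ × ℤ)) :
    2 * Nat.card (thinGraph S).edgeSet + 2 * triCount S = 2 * bondCount S := by
  classical
  set D := (S ×ˢ S).filter fun d => Adj d.1 d.2 with hD
  set R := (S ×ˢ S).filter fun d => Removed S d.1 d.2 with hR
  have hRD : R ⊆ D := fun d hd => mem_filter.2 ⟨(mem_filter.1 hd).1, (mem_filter.1 hd).2.adj⟩
  have hDc : D.card = 2 * bondCount S := by rw [hD, card_filter_adj_prod, adjCount_eq_two_mul_bondCount]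
  have hRc : R.card = 2 * triCount S := by rw [hR, card_filter_removed_prod]
  have hle := card_le_card hRD
  -- the ordered thinned bonds are `D \ R`
  have key : 2 * Nat.card (thinGraph S).edgeSet = (D \ R).card := by
    rw [Nat.card_eq_fintype_card, ← SimpleGraph.edgeFinset_card, SimpleGraph.two_mul_card_edgeFinset]
    refine card_bij' (fun e _ => (e.1.1, e.2.1))
      (fun d hd => (⟨d.1, (mem_product.1 (mem_filter.1 (mem_sdiff.1 hd).1).1).1⟩,
        ⟨d.2, (mem_product.1 (mem_filter.1 (mem_sdiff.1 hd).1).1).2⟩)) ?_ ?_ ?_ ?_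
    · rintro ⟨⟨p, hp⟩, ⟨q, hq⟩⟩ he
      simp only [mem_filter, mem_univ, true_and, thinGraph_adj] at he
      simp only [hD, hR, mem_sdiff, mem_filter, mem_product]
      exact ⟨⟨⟨hp, hq⟩, he.1⟩, fun h => he.2 h.2⟩
    · rintro ⟨p, q⟩ hd
      simp only [hD, hR, mem_sdiff, mem_filter, mem_product] at hd
      simp only [mem_filter, mem_univ, true_and, thinGraph_adj]
      exact ⟨hd.1.2, fun h => hd.2 ⟨hd.1.1, h⟩⟩
    · rintro ⟨⟨p, hp⟩, ⟨q, hq⟩⟩ _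
      rfl
    · rintro ⟨p, q⟩ _
      rfl
  rw [key, card_sdiff_of_subset hRD, hDc, hRc]
  omega

/-- **Euler's inequality for animals: `A + n ≤ b + 1`.** For every non-empty bond-connected
finite `S ⊂ A₂`, the number of unit triangles plus the number of labels is at most the number of
bonds plus one (with equality iff the animal has no holes; Gutman–Cyvin: "# internal edges
`= h - 1 + n_i`" for benzenoids).  Proof: the thinned bond graph is connected with `b - A` edges,
and a connected graph on `n` vertices has at least `n - 1` edges.
[cite: GutmanCyvin1989, Ch. 3 §3.2] -/
theorem triCount_add_card_le_bondCount_add_one {S : Finset (ℤ × ℤ)} (hne : S.Nonempty)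
    (hS : IsLabelConnected S) : triCount S + S.card ≤ bondCount S + 1 := by
  have hconn := thinGraph_connected hne hS
  have h1 := hconn.card_vert_le_card_edgeSet_add_one
  rw [Nat.card_eq_fintype_card, Fintype.card_coe] at h1
  have h2 := two_mul_card_edgeSet_thinGraph S
  omega

/-! ## §4 Row-convex animals: `b + 1 = A + n` -/

/-- `S` is **row-convex**: every horizontal row of `S` is an integer interval.
[cite: HararyHarborth1976, hexagonal animals] -/
def IsRowConvex (S : Finset (ℤ × ℤ)) : Prop :=
  ∀ t a m c : ℤ, (a, t) ∈ S → (c, t) ∈ S → a ≤ m → m ≤ c → (m, t) ∈ S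

/-- Configurations attaining Harborth's bound are row-convex
(`HarborthSpiral.mem_of_adjCount_eq`). [cite: HararyHarborth1976, hexagonal animals] -/
theorem isRowConvex_of_adjCount_eq {S : Finset (ℤ × ℤ)}
    (hmax : 2 * harborthNumber S.card ≤ (adjCount S : ℤ)) : IsRowConvex S :=
  fun _ _ _ _ ha hc ham hmc => mem_of_adjCount_eq hmax ha hc ham hmc

/-- In an integer INTERVAL `R` (convex finite set), the elements with a successor in `R` are all
but the last one: `#{m ∈ R : m + 1 ∈ R} + 1 = #R`. [folklore] -/
private theorem card_filter_succ_mem_add_one_eq (R : Finset ℤ) (hR : R.Nonempty)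
    (hconv : ∀ a c m : ℤ, a ∈ R → c ∈ R → a ≤ m → m ≤ c → m ∈ R) :
    (R.filter fun m => m + 1 ∈ R).card + 1 = R.card := by
  have h : (R.filter fun m => m + 1 ∈ R) = R.erase (R.max' hR) := by
    ext m
    rw [mem_filter, mem_erase]
    constructor
    · rintro ⟨hm, hm1⟩
      refine ⟨fun h => ?_, hm⟩
      have := R.le_max' _ hm1
      omega
    · rintro ⟨hne, hm⟩
      have hlt : m < R.max' hR := lt_of_le_of_ne (R.le_max' _ hm) hne
      exact ⟨hm, hconv m (R.max' hR) (m + 1) hm (R.max'_mem hR) (by omega) (by omega)⟩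
  rw [h, card_erase_of_mem (R.max'_mem hR)]
  have := hR.card_pos
  omega

/-- In a row-convex `S`, `horizBonds S + #rows = |S|` (each interval row of `k` labels has exactly
`k - 1` horizontal bonds). [cite: HararyHarborth1976, hexagonal animals] -/
theorem horizBonds_add_card_rows_eq {S : Finset (ℤ × ℤ)} (hconv : IsRowConvex S) :
    horizBonds S + (S.image Prod.snd).card = S.card := by
  rw [horizBonds_eq_sum, card_eq_sum_ones (S.image Prod.snd), ← sum_add_distrib, card_eq_sum_card_row]
  refine sum_congr rfl fun t ht => ?_
  exact card_filter_succ_mem_add_one_eq _ (row_nonempty_iff.2 ht) fun a c m ha hc ham hmc =>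
    mem_row.2 (hconv t a m c (mem_row.1 ha) (mem_row.1 hc) ham hmc)

/-- The unit triangles between rows `t` and `t + 1`: up triangles `{(m,t),(m+1,t),(m,t+1)}` and
down triangles `{(m,t),(m-1,t+1),(m,t+1)}`, both indexed by `m ∈ row t`.
[cite: DavoliPiovanoStefanelli2017, (25) p. 635] -/
def rowTri (S : Finset (ℤ × ℤ)) (t : ℤ) : ℕ :=
  ((row S t).filter fun m => m + 1 ∈ row S t ∧ m ∈ row S (t + 1)).card +
    ((row S t).filter fun m => m - 1 ∈ row S (t + 1) ∧ m ∈ row S (t + 1)).card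

/-- Fibrewise counting along `Prod.snd` (as in `TriangularLatticeRows.lean`). [folklore] -/
private theorem card_filter_eq_sum_rows' (S : Finset (ℤ × ℤ)) (P : ℤ × ℤ → Prop) [DecidablePred P]
    (Q : ℤ → ℤ → Prop) [∀ t, DecidablePred (Q t)] (hPQ : ∀ m t, (m, t) ∈ S → (P (m, t) ↔ Q t m)) :
    (S.filter P).card = ∑ t ∈ S.image Prod.snd, ((row S t).filter (Q t)).card := by
  rw [card_eq_sum_card_fiberwise (f := Prod.snd) (s := S.filter P) (t := S.image Prod.snd)
    fun q hq => mem_image_of_mem _ (mem_filter.1 hq).1]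
  refine sum_congr rfl fun t _ => ?_
  have h : (S.filter P).filter (fun q => q.2 = t) =
      ((row S t).filter (Q t)).map ⟨fun m => (m, t), fun a b h => (Prod.mk.injEq _ _ _ _ ▸ h).1⟩ := by
    ext ⟨a, b⟩
    simp only [mem_filter, mem_map, Function.Embedding.coeFn_mk, Prod.mk.injEq, mem_row]
    constructor
    · rintro ⟨⟨h1, h2⟩, rfl⟩
      exact ⟨a, ⟨h1, (hPQ a b h1).1 h2⟩, rfl, rfl⟩
    · rintro ⟨m, ⟨h1, h2⟩, rfl, rfl⟩
      exact ⟨⟨h1, (hPQ m t h1).2 h2⟩, rfl⟩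
  rw [h, card_map]

/-- `A(S) = ∑_t rowTri S t` over the occupied rows. [cite: DavoliPiovanoStefanelli2017, (25) p. 635] -/
theorem triCount_eq_sum_rowTri (S : Finset (ℤ × ℤ)) :
    triCount S = ∑ t ∈ S.image Prod.snd, rowTri S t := by
  unfold triCount rowTri upTri downTri
  rw [sum_add_distrib]
  congr 1
  · exact card_filter_eq_sum_rows' S _ (fun t m => m + 1 ∈ row S t ∧ m ∈ row S (t + 1))
      fun m t _ => by rw [mem_row, mem_row]
  · exact card_filter_eq_sum_rows' S _ (fun t m => m - 1 ∈ row S (t + 1) ∧ m ∈ row S (t + 1))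
      fun m t _ => by rw [mem_row, mem_row]

/-- **The zig-zag strip** between a lower row `R` and an upper row `R'`: the bonds
`(m, t) — (m, t+1)` are coded by the even integers `2m`, the bonds `(m, t) — (m-1, t+1)` by the odd
integers `2m - 1`; consecutive codes are bonds sharing a unit triangle. [folklore] -/
def zig (R R' : Finset ℤ) : Finset ℤ :=
  ((R.filter fun m => m ∈ R').image fun m => 2 * m) ∪
    ((R.filter fun m => m - 1 ∈ R').image fun m => 2 * m - 1)

/-- Membership in the strip (unfolding). [folklore] -/
private theorem mem_zig {R R' : Finset ℤ} {s : ℤ} :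
    s ∈ zig R R' ↔ (∃ m, m ∈ R ∧ m ∈ R' ∧ s = 2 * m) ∨ (∃ m, m ∈ R ∧ m - 1 ∈ R' ∧ s = 2 * m - 1) := by
  simp only [zig, mem_union, mem_image, mem_filter]
  constructor
  · rintro (⟨m, ⟨h1, h2⟩, rfl⟩ | ⟨m, ⟨h1, h2⟩, rfl⟩)
    · exact Or.inl ⟨m, h1, h2, rfl⟩
    · exact Or.inr ⟨m, h1, h2, rfl⟩
  · rintro (⟨m, h1, h2, rfl⟩ | ⟨m, h1, h2, rfl⟩)
    · exact Or.inl ⟨m, ⟨h1, h2⟩, rfl⟩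
    · exact Or.inr ⟨m, ⟨h1, h2⟩, rfl⟩

/-- Even codes of the strip. [folklore] -/
private theorem two_mul_mem_zig {R R' : Finset ℤ} {m : ℤ} : 2 * m ∈ zig R R' ↔ m ∈ R ∧ m ∈ R' := by
  rw [mem_zig]
  constructor
  · rintro (⟨m', h1, h2, h⟩ | ⟨m', h1, h2, h⟩)
    · obtain rfl : m = m' := by omega
      exact ⟨h1, h2⟩
    · omega
  · rintro ⟨h1, h2⟩
    exact Or.inl ⟨m, h1, h2, rfl⟩

/-- Odd codes of the strip. [folklore] -/
private theorem two_mul_sub_one_mem_zig {R R' : Finset ℤ} {m : ℤ} :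
    2 * m - 1 ∈ zig R R' ↔ m ∈ R ∧ m - 1 ∈ R' := by
  rw [mem_zig]
  constructor
  · rintro (⟨m', h1, h2, h⟩ | ⟨m', h1, h2, h⟩)
    · omega
    · obtain rfl : m = m' := by omega
      exact ⟨h1, h2⟩
  · rintro ⟨h1, h2⟩
    exact Or.inr ⟨m, h1, h2, rfl⟩

/-- The strip has `rowBonds` codes. [cite: HararyHarborth1976, hexagonal animals] -/
private theorem card_zig_row (S : Finset (ℤ × ℤ)) (t : ℤ) :
    (zig (row S t) (row S (t + 1))).card = rowBonds S t := by
  unfold zig rowBonds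
  rw [card_union_of_disjoint, card_image_of_injective _ (fun a b h => by simpa using h),
    card_image_of_injective _ (fun a b (h : 2 * a - 1 = 2 * b - 1) => by omega)]
  rw [disjoint_left]
  rintro s h1 h2
  obtain ⟨a, -, rfl⟩ := mem_image.1 h1
  obtain ⟨b, -, h⟩ := mem_image.1 h2
  omega

/-- Consecutive codes of the strip are exactly the unit triangles between the two rows:
`#{s ∈ zig : s + 1 ∈ zig} = rowTri`. [cite: DavoliPiovanoStefanelli2017, (25) p. 635] -/
private theorem card_filter_succ_mem_zig_row (S : Finset (ℤ × ℤ)) (t : ℤ) :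
    ((zig (row S t) (row S (t + 1))).filter fun s => s + 1 ∈ zig (row S t) (row S (t + 1))).card =
      rowTri S t := by
  set R := row S t
  set R' := row S (t + 1)
  have hsplit : ((zig R R').filter fun s => s + 1 ∈ zig R R') =
      ((R.filter fun m => m + 1 ∈ R ∧ m ∈ R').image fun m => 2 * m) ∪
        ((R.filter fun m => m - 1 ∈ R' ∧ m ∈ R').image fun m => 2 * m - 1) := by
    ext s
    simp only [mem_filter, mem_union, mem_image]
    constructor
    · rintro ⟨hs, hs1⟩
      rcases mem_zig.1 hs with ⟨m, h1, h2, rfl⟩ | ⟨m, h1, h2, rfl⟩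
      · -- `s = 2m`, `s + 1 = 2(m+1) - 1`
        have : 2 * (m + 1) - 1 ∈ zig R R' := by convert hs1 using 1; ring
        rw [two_mul_sub_one_mem_zig] at this
        exact Or.inl ⟨m, ⟨h1, this.1, h2⟩, rfl⟩
      · -- `s = 2m - 1`, `s + 1 = 2m`
        have : 2 * m ∈ zig R R' := by convert hs1 using 1; ring
        rw [two_mul_mem_zig] at this
        exact Or.inr ⟨m, ⟨h1, h2, this.2⟩, rfl⟩
    · rintro (⟨m, ⟨h1, h2, h3⟩, rfl⟩ | ⟨m, ⟨h1, h2, h3⟩, rfl⟩)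
      · refine ⟨two_mul_mem_zig.2 ⟨h1, h3⟩, ?_⟩
        have : 2 * (m + 1) - 1 ∈ zig R R' := two_mul_sub_one_mem_zig.2 ⟨h2, by simpa using h3⟩
        convert this using 1; ring
      · refine ⟨two_mul_sub_one_mem_zig.2 ⟨h1, h2⟩, ?_⟩
        have : 2 * m ∈ zig R R' := two_mul_mem_zig.2 ⟨h1, h3⟩
        convert this using 1; ring
  rw [hsplit, card_union_of_disjoint, card_image_of_injective _ (fun a b h => by simpa using h),
    card_image_of_injective _ (fun a b (h : 2 * a - 1 = 2 * b - 1) => by omega)]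
  · rfl
  rw [disjoint_left]
  rintro s h1 h2
  obtain ⟨a, -, rfl⟩ := mem_image.1 h1
  obtain ⟨b, -, h⟩ := mem_image.1 h2
  omega

/-- `rowTri ≤ rowBonds - 1` whenever the two rows are joined (a non-empty strip), and in general
`rowTri + 1 ≤ rowBonds` or the strip is empty. [folklore] -/
private theorem rowTri_add_one_le_rowBonds (S : Finset (ℤ × ℤ)) (t : ℤ) (h : 1 ≤ rowBonds S t) :
    rowTri S t + 1 ≤ rowBonds S t := by
  rw [← card_zig_row, ← card_filter_succ_mem_zig_row]
  rw [← card_zig_row] at h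
  exact card_filter_succ_mem_add_one_le _ (card_pos.1 (by omega))

/-- **The strip of a row-convex configuration is an interval**, so it carries exactly
`rowBonds - 1` triangles: `rowTri S t + 1 = rowBonds S t` when rows `t`, `t+1` are joined.
[cite: HararyHarborth1976, hexagonal animals] -/
private theorem rowTri_add_one_eq_rowBonds {S : Finset (ℤ × ℤ)} (hconv : IsRowConvex S) (t : ℤ)
    (h : 1 ≤ rowBonds S t) : rowTri S t + 1 = rowBonds S t := by
  rw [← card_zig_row, ← card_filter_succ_mem_zig_row]
  rw [← card_zig_row] at h
  refine card_filter_succ_mem_add_one_eq _ (card_pos.1 (by omega)) ?_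
  -- convexity of the strip from the convexity of the two rows
  have hR : ∀ a c m : ℤ, a ∈ row S t → c ∈ row S t → a ≤ m → m ≤ c → m ∈ row S t :=
    fun a c m ha hc ham hmc => mem_row.2 (hconv t a m c (mem_row.1 ha) (mem_row.1 hc) ham hmc)
  have hR' : ∀ a c m : ℤ, a ∈ row S (t + 1) → c ∈ row S (t + 1) → a ≤ m → m ≤ c →
      m ∈ row S (t + 1) :=
    fun a c m ha hc ham hmc => mem_row.2 (hconv (t + 1) a m c (mem_row.1 ha) (mem_row.1 hc) ham hmc)
  intro s₁ s₂ s hs₁ hs₂ h1 h2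
  -- lower witnesses (from `s₁`) and upper witnesses (from `s₂`) in both rows
  obtain ⟨a, a', ha, ha', hale, ha'le⟩ : ∃ a a', a ∈ row S t ∧ a' ∈ row S (t + 1) ∧
      2 * a - 1 ≤ s₁ ∧ 2 * a' ≤ s₁ := by
    rcases mem_zig.1 hs₁ with ⟨m, hm, hm', rfl⟩ | ⟨m, hm, hm', rfl⟩
    · exact ⟨m, m, hm, hm', by omega, le_rfl⟩
    · exact ⟨m, m - 1, hm, hm', le_rfl, by omega⟩
  obtain ⟨c, c', hc, hc', hcle, hc'le⟩ : ∃ c c', c ∈ row S t ∧ c' ∈ row S (t + 1) ∧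
      s₂ ≤ 2 * c ∧ s₂ ≤ 2 * c' + 1 := by
    rcases mem_zig.1 hs₂ with ⟨m, hm, hm', rfl⟩ | ⟨m, hm, hm', rfl⟩
    · exact ⟨m, m, hm, hm', le_rfl, by omega⟩
    · exact ⟨m, m - 1, hm, hm', by omega, by omega⟩
  rcases Int.even_or_odd' s with ⟨m, rfl | rfl⟩
  · -- `s = 2m`
    exact two_mul_mem_zig.2 ⟨hR a c m ha hc (by omega) (by omega), hR' a' c' m ha' hc' (by omega) (by omega)⟩
  · -- `s = 2m + 1 = 2(m+1) - 1`
    have : 2 * (m + 1) - 1 ∈ zig (row S t) (row S (t + 1)) :=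
      two_mul_sub_one_mem_zig.2 ⟨hR a c (m + 1) ha hc (by omega) (by omega),
        by simpa using hR' a' c' m ha' hc' (by omega) (by omega)⟩
    convert this using 1; ring

/-- An empty upper row: no triangles between the rows. [folklore] -/
private theorem rowTri_eq_zero_of_empty (S : Finset (ℤ × ℤ)) (t : ℤ) (h : row S (t + 1) = ∅) :
    rowTri S t = 0 := by
  unfold rowTri
  rw [h]
  simp

/-- An empty upper row: no bonds between the rows. [folklore] -/
private theorem rowBonds_eq_zero_of_empty' (S : Finset (ℤ × ℤ)) (t : ℤ) (h : row S (t + 1) = ∅) :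
    rowBonds S t = 0 := by
  unfold rowBonds
  rw [h]
  simp

/-- **`b + 1 = A + n` for bond-connected row-convex animals** (Gutman–Cyvin's
"`# internal edges = h - 1 + n_i`" for benzenoid systems): the horizontal bonds number
`n - #rows`, and between each of the `#rows - 1` pairs of consecutive occupied rows the strip of
`E ≥ 1` bonds carries exactly `E - 1` unit triangles. [cite: GutmanCyvin1989, Ch. 3 §3.2] -/
theorem bondCount_add_one_eq_of_isRowConvex {S : Finset (ℤ × ℤ)} (hne : S.Nonempty)
    (hS : IsLabelConnected S) (hconv : IsRowConvex S) :
    bondCount S + 1 = triCount S + S.card := by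
  set T := S.image Prod.snd with hT
  have hTne : T.Nonempty := hne.image _
  set t₁ := T.max' hTne with ht₁
  have ht₁T : t₁ ∈ T := T.max'_mem hTne
  obtain ⟨q, hq, hqt⟩ : ∃ q ∈ S, q.2 = t₁ := by simpa [hT] using ht₁T
  -- the top row has no bonds and no triangles above it
  have htop : row S (t₁ + 1) = ∅ := by
    by_contra h
    have : t₁ + 1 ∈ T := row_nonempty_iff.1 (nonempty_iff_ne_empty.2 h)
    have := T.le_max' _ this
    omega
  -- every other occupied row is joined to the next one
  have hmid : ∀ t ∈ T.erase t₁, rowBonds S t = rowTri S t + 1 := by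
    intro t ht
    have htT : t ∈ T := mem_of_mem_erase ht
    have hlt : t < t₁ := lt_of_le_of_ne (T.le_max' _ htT) (ne_of_mem_erase ht)
    obtain ⟨p, hp, hpt⟩ : ∃ p ∈ S, p.2 = t := by simpa [hT] using htT
    have h1 : 1 ≤ rowBonds S t :=
      one_le_rowBonds_of_isLabelConnected hS hp hq (by omega) (by omega)
    exact (rowTri_add_one_eq_rowBonds hconv t h1).symm
  have hsumB : ∑ t ∈ T, rowBonds S t = ∑ t ∈ T.erase t₁, rowTri S t + (T.card - 1) := by
    rw [← sum_erase_add _ _ ht₁T, rowBonds_eq_zero_of_empty' S t₁ htop, add_zero,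
      sum_congr rfl hmid, sum_add_distrib, sum_const, smul_eq_mul, mul_one,
      card_erase_of_mem ht₁T]
  have hsumT : ∑ t ∈ T, rowTri S t = ∑ t ∈ T.erase t₁, rowTri S t := by
    rw [← sum_erase_add _ _ ht₁T, rowTri_eq_zero_of_empty S t₁ htop, add_zero]
  have hH := horizBonds_add_card_rows_eq hconv
  have hVD := vertBonds_add_diagBonds_eq_sum S
  have hA := triCount_eq_sum_rowTri S
  rw [← hT] at hH hVD hA
  have hT1 : 1 ≤ T.card := hTne.card_pos
  unfold bondCount
  omega

/-- **`b + 1 = A + n` for every bond-connected configuration attaining Harborth's bound**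
(`2 [3n - √(12n-3)] ≤ adjCount S`): such configurations are row-convex. This is the counting
content of "all bounded faces are triangles" for contact-maximal configurations on `A₂`.
[cite: HararyHarborth1976, hexagonal animals] -/
theorem bondCount_add_one_eq_of_adjCount_eq {S : Finset (ℤ × ℤ)} (hne : S.Nonempty)
    (hS : IsLabelConnected S) (hmax : 2 * harborthNumber S.card ≤ (adjCount S : ℤ)) :
    bondCount S + 1 = triCount S + S.card :=
  bondCount_add_one_eq_of_isRowConvex hne hS (isRowConvex_of_adjCount_eq hmax)

/-- For a row-convex `S` the bonds between rows `t` and `t + 1` number at most the unit triangles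
between them plus one: `rowBonds S t ≤ rowTri S t + 1` (equality when the two rows are joined,
`0 ≤ 0 + 1` otherwise). [cite: GutmanCyvin1989, Ch. 3 §3.2] -/
theorem rowBonds_le_rowTri_add_one {S : Finset (ℤ × ℤ)} (hconv : IsRowConvex S) (t : ℤ) :
    rowBonds S t ≤ rowTri S t + 1 := by
  rcases Nat.eq_zero_or_pos (rowBonds S t) with h | h
  · omega
  · rw [rowTri_add_one_eq_rowBonds hconv t h]

/-- **`b + Z ≤ A + n` for row-convex label sets** (no connectedness assumed), where `Z` is the number
of occupied rows `t` carrying no bond to row `t + 1` (at least one: the top row; one more for every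
further bond-component's top row): the horizontal bonds number `n − #rows`
(`horizBonds_add_card_rows_eq`) and each pair of consecutive rows carries at most `rowTri + 1` bonds
(`rowBonds_le_rowTri_add_one`).  For bond-connected `S` this is the inequality half of
`bondCount_add_one_eq_of_isRowConvex`. [cite: GutmanCyvin1989, Ch. 3 §3.2] -/
theorem bondCount_add_card_filter_rowBonds_eq_zero_le {S : Finset (ℤ × ℤ)} (hconv : IsRowConvex S) :
    bondCount S + ((S.image Prod.snd).filter fun t => rowBonds S t = 0).card ≤
      triCount S + S.card := by
  set T := S.image Prod.snd with hT
  have hH := horizBonds_add_card_rows_eq hconv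
  have hVD := vertBonds_add_diagBonds_eq_sum S
  have hA := triCount_eq_sum_rowTri S
  rw [← hT] at hH hVD hA
  have key : ∑ t ∈ T, rowBonds S t + (T.filter fun t => rowBonds S t = 0).card ≤
      ∑ t ∈ T, rowTri S t + T.card := by
    rw [card_filter, ← sum_add_distrib, card_eq_sum_ones T, ← sum_add_distrib]
    refine sum_le_sum fun t _ => ?_
    have := rowBonds_le_rowTri_add_one hconv t
    split_ifs with h <;> omega
  unfold bondCount
  omega

end HarborthSpiral

end Literature.Geometry.DiscreteGeometry

end
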